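import Summits.QuantumFields.YangMills.Theorems.UnitScaleTiltProp7OneFormGradientSup
import Summits.QuantumFields.YangMills.Theorems.UnitScaleTiltProp7SectET3Eq3124RowsT3
import Summits.QuantumFields.YangMills.Theorems.UnitScaleTiltProp7SectET3DeltaPiT3PInv
import HarnessLib

/-!
# Route `UnitScaleTilt`, crux K1 «MinimiserStabilityRegPr» (stmt-QuantumFields-19200), EX row `norm_G`, NORM_G ROAD N6 item 6 («HESS-T1», ★p1 g27 CHAIR WORD №28∕№29 (4)) —
# **THE HESSIAN ROW OF `(Δ₀|_{N_S})⁻¹`: for a residual pure gauge `ψ ∈ N_S(U₀)` with `Δ^η_{U₀}ψ = φ`, EVERY second covariant derivative `∇^η_{U₀,μ}(D_{U₀}ψ)_ν` is bounded in sup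
# by the sups of `ψ`, `φ`, `D_{U₀}φ` and the gauge-mode letter(s) `‖Δx(U₀)(Dψ)‖_∞` ∕ `‖Δ^η(U₀)(Dψ)‖_∞` — BY COMPOSITION: (OF-GRAD) ✓p767711 at the one-form `X := D_{U₀}ψ`, whose
# one-form equation `Δ_a(Dψ) = Δx(Dψ) + Dφ` is EXACT on `N_S` ((3.115): `Q_kDψ = 0`; `R_S` fixes `Δ^η N_S`), fed by T1-core ✓p765411 for `‖Dψ‖_∞`**

Cell `ym3-torus` (HUMAN RULING D-0037; rung R3 = SU(2) YM₃ on T³ — NOT d = 4, NOT infinite volume, NOT a mass gap, NOT Clay).  Width seat `ym3-torus-px17` (gen 11).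
THEOREMS ONLY (0 `def`, 0 `sorry`, default heartbeats); `--supports stmt-QuantumFields-19200 --as helper`; count-neutral.

WHY (LOCATE-N6 fa94c431 §3∕§4 item 6, px19 g14).  The (∇)-half of the `Δ′` words of N6 (`G_π = G₀(1 − Δ′G₀)⁻¹` in the `𝒳 → 𝒴` currency) meets the covariant HESSIAN of the scalar
Green operator on `N_S`: `ψ := (Δ₀|_{N_S})⁻¹φ₁` with `φ₁ = R_SG′ᴾj` of BOUNDED COVARIANT GRADIENT.  The LOCATE proposed T1 on the differentiated equation with curvature commutators
(≈ 300 l.).  THIS FILE takes the shorter road: the one-form `X := D_{U₀}ψ` satisfies, for `ψ ∈ N_S` and ANY Hessian slot `Δx`, the one-form equation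
`Δ_a(U₀)(Dψ) = Δx(U₀)(Dψ) + D_{U₀}(Δ^η_{U₀}ψ)` EXACTLY (✓`laplaceA_apply`; `Q_k(Dψ) = η•Q_{DS}ψ = 0` ✓`QL2_DL2_eq_zero_of_mem_NS`; `R_S(Δ^ηψ) = Δ^ηψ` ✓`RS_apply_covLapSite_of_mem`) — the
mechanism of ✓`Prop7SectET3Eq3124Rows.laplaceA_DL2_of_mem_NS` with the slot term kept — so px5's (OF-GRAD) ✓`Prop7OneFormGradientSup.norm_covGradT_le_of_letters` (T1 ON BONDS, all
Weitzenböck∕curvature commutators inside O1 ✓`Prop7OneFormKatoForm`) bounds `covGradT η (bgUnits U₀) X μ ν x` = the Hessian of `ψ`, with its (D) and (Q) letters DISCHARGED AS `0`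
(`D(1 − R_S)D*(Dψ) = D(1 − R_S)Δ^ηψ = 0`, `Q_k†aQ_k(Dψ) = 0`), its source letter `‖Y‖_∞ ≤ M_C + G_φ` (`Y = Δx(Dψ) + Dφ`), its slot letter `‖(Δx − Δ^η)(Dψ)‖_∞ ≤ M_C + M_E`, and its
component sup `s` FED BY T1-core ✓`Prop7MassiveSolutionGradientSup.norm_equiv_DL2_le_of_sup` at `u := ψ`, `q := −φ` (`‖(Dψ)(p)‖ ≤ 2·(C_g·(M_ψ·c(ε₀) + M_φ) + 2√2·48ε₀·M_ψ)`, all `p`).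
The two gauge-mode letters are print's (3.117) CURRENT PAIRING (`Δ^η(Dλ) = O(J)·λ`, `‖J₁‖ ≤ αη³` — ✓`Prop7DeltaPiDefectPairing.inner_DL2_toL2S_DeltaEta_toL2`, pointwise edition (C-val) =
★p1 g27's ⧗FILE A `…CurrentPairingPointwise`): `M_E` for `Δ^η(Dψ)`, `M_C` for `Δx(Dψ)` (`= 0` at the Π-slot ✓`DeltaPiSlotP_kills_NS`, `= M_E` at `DeltaEtaSlot`) — DISPLAYED here.

WHAT IS PROVED (ns `Summit.QuantumFields.YangMills.Theorems.Prop7GaugeModeHessianRow`; member `F`, `h : n ≤ K`, weights `c₀ cB`, coupling `a`, slot `Δx`, background `U₀` with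
`RegPr F n K ε₀ U₀`, `0 < ε₀ ≤ 1`).
* §1 ★ `laplaceA_DL2_eq_of_mem_NS` — `Δ_a(U₀)(Dψ) = Δx(U₀)(Dψ) + D(Δ^ηψ)` for `ψ ∈ N_S(U₀)` (any slot, any `a`; no class hypothesis);
  `laplaceA_toL2_symm_DL2_eq` (the same as the `hXY` of (OF-GRAD) for `X := toL2⁻¹(Dψ)`, `Y := toL2⁻¹(Δx(Dψ) + D(Δ^ηψ))`); the vanishing letters `DL2_sub_RS_DstarL2_DL2_eq_zero`
  ((D) `= 0`) and `adjoint_Qk_smul_Qk_DL2_eq_zero` ((Q) `= 0`).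
* §2 ★★ `norm_toL2_symm_DL2_le_of_sup` — T1-core read on the route's bonds: `‖(toL2⁻¹(Dψ))(b)‖ ≤ T₁(M_ψ, M_φ)` for ALL `b` (`‖frobEquiv v‖ ≤ ‖v‖` ✓`norm_frobEquiv_le`).
* §3 ★★★ `norm_covGradT_DL2_le_of_letters` — THE HESSIAN ROW: for `ψ ∈ N_S(U₀)` with global letters `‖ψ‖_∞ ≤ M_ψ`, `‖Δ^ηψ‖_∞ ≤ M_φ` (T1-core's torus currency), `‖(toL2⁻¹(D(Δ^ηψ)))(b)‖ ≤ G_φ`,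
  `‖(toL2⁻¹(Δx(Dψ)))(b)‖ ≤ M_C`, `‖(toL2⁻¹(Δ^η(Dψ)))(b)‖ ≤ M_E`, the room `hroom` and the margin `hsmall` of T1:
  `‖covGradT (eta F n K) (bgUnits F K U₀) (toL2⁻¹(Dψ)) μ ν x‖ ≤ B(T₁(M_ψ,M_φ), M_C + G_φ, M_C + M_E)` with `B` = (OF-GRAD)'s displayed bound at `MD = MQ = 0`.
* §4 slot editions: ★★★ `norm_covGradT_DL2_le_DeltaEtaSlot` (`Δx := DeltaEtaSlot`: ONE gauge-mode letter `M_E`, `M_C := M_E`) and ★★★ `norm_covGradT_DL2_le_DeltaPiSlotP`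
  (`Δx := DeltaPiSlotP`, `0 ≤ a`: `M_C := 0` by ✓`DeltaPiSlotP_kills_NS`).
HYP-SAT (★★OWNER RULING №42): `RegPr` + `0 < ε₀ ≤ 1` (EX class); `ψ ∈ N_S` (the consumer's `ψ` is a gauge-restoring potential, in `N_S` by construction); the sup letters are data
(finite maxima) — `M_E`∕`M_C` are the (C-val) row of ★p1's ⧗FILE A at `λ := ψ` (class (1) socket of the N6 road, `= c·α·2M_ψ`); `hroom` = CHAIR WORD №1 class; `hsmall` = the T1 margin
(`.choose`-window class of record, ✓p765411∕✓p767711∕✓p768169).  Conclusions non-vacuous; no `Prop` placeholder.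
HONEST SCOPE.  Composition of landed theorems ((OF-GRAD), T1-core, the (3.115)∕`R_S` identities); the max-principle analysis is T1-core's and (G1-3a)'s, not re-done; the (C-val) letter is
displayed, not proved; nothing of N6, `norm_G`, the eight EX print rows, `hThm2S`, EX `stub_existenceMinimalOrbit`, `MinimiserStabilityRegPr` (19200) or R3 is proved; the Yang–Mills
mass gap is NOT proved.

References: T. Bałaban, CMP **99** (1985) 389–434 [Balaban1985BackgroundPropagators] ((3.23)–(3.26) pp.394–395, (3.115)–(3.117) pp.418–419, Thm 3.1 (3.42)–(3.45) pp.397–398,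
Lemma 3.2 (3.45)–(3.48) pp.398–399, p.423 lines 1–9); CMP **102** (1985) 277–309 [Balaban1985Variational] ((19) p.281, (134)–(135) p.298); CMP **96** (1984) 223–250
[Balaban1984PropagatorsII] (Lemma 2.1 pp.227–228).
-/

set_option autoImplicit false

noncomputable section

open scoped BigOperators Matrix.Norms.L2Operator InnerProductSpace ComplexConjugate

namespace Summit.QuantumFields.YangMills.Theorems.Prop7GaugeModeHessianRow

open Literature.MathematicalPhysics.QuantumFieldTheory.Balaban1983to89
open Literature.MathematicalPhysics.QuantumFieldTheory.Balaban1983to89.T3ContinuumYM3Torus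
open Literature.MathematicalPhysics.QuantumFieldTheory.Balaban1983to89.T3PrintedRegularMinimiser (RegPr)
open T3SectALandauChart (covGradT bgUnits eta eta_pos)
open B4Sect5Torus (TSite)
open B9SectCLatticeCarrier (Bond)
open B9Eq311L2Pairing (WL2)
open B11Eq103H1Complex (SiteL2K BondL2K)
open Summit.QuantumFields.YangMills.Theorems.Prop7SectET3Transport (periodsT3 siteEquiv bondEquiv)
open Summit.QuantumFields.YangMills.Theorems.Prop7SectET3HilbertLetters (W₂ frobEquiv toL2 toL2S QL2 DL2 DstarL2 covLapSite toL2_symm_apply)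
open Summit.QuantumFields.YangMills.Theorems.Prop7SectET3WilsonHessian (DeltaEta DeltaEtaSlot)
open Summit.QuantumFields.YangMills.Theorems.Prop7SectET3GaugeProjector (NS RS QL2_DL2_eq_zero_of_mem_NS RS_apply_covLapSite_of_mem)
open Summit.QuantumFields.YangMills.Theorems.Prop7SectET3CurvedPropagators (Qk laplaceA laplaceA_apply)
open Summit.QuantumFields.YangMills.Theorems.Prop7SectET3DeltaPiPInv (DeltaPiSlotP DeltaPiSlotP_kills_NS)
open Summit.QuantumFields.YangMills.Theorems.Prop7RieszTauFrobNorm (norm_frobEquiv_le)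
open Summit.QuantumFields.YangMills.Theorems.Prop7OneFormGradientSup (norm_covGradT_le_of_letters)
open Summit.QuantumFields.YangMills.Theorems.Prop7MassiveSolutionGradientSup (norm_equiv_DL2_le_of_sup)
open Summit.QuantumFields.YangMills.Theorems.Prop7CurvedMemberLocalGradient (exists_curved_localGradient)
open Summit.QuantumFields.YangMills.Theorems.AxialGaugeChartGlue (norm_bgOfCfg_axialT_sub_le)

variable (F : T3Family) {n K : ℕ} (h : n ≤ K) (c₀ cB : ℝ) [Fact (0 < c₀)] [Fact (0 < cB)] (a : ℝ)
  (Δx : GaugeField (F.P K) 0 (Matrix.specialUnitaryGroup (Fin 2) ℂ) → (BondL2K ℂ 3 (periodsT3 F K) c₀ W₂ →ₗ[ℂ] BondL2K ℂ 3 (periodsT3 F K) c₀ W₂))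
  (U₀ : GaugeField (F.P K) 0 (Matrix.specialUnitaryGroup (Fin 2) ℂ))
  {ε₀ : ℝ} (hε₀ : 0 < ε₀) (hε1 : ε₀ ≤ 1) (hreg : RegPr F n K ε₀ U₀)

/-! ## §1 The one-form equation of a residual pure gauge mode, and its vanishing (D)∕(Q) letters -/

/-- ★ **`Δ_a(U₀)(D_{U₀}ψ) = Δx(U₀)(D_{U₀}ψ) + D_{U₀}(Δ^η_{U₀}ψ)` FOR `ψ ∈ N_S(U₀)`** — any slot `Δx`, any coupling `a`, no class hypothesis: the `Q_k†aQ_k` term vanishes by (3.115)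
(`Q_k(Dψ) = η•Q_{DS}ψ = 0` on `N_S`) and `D R_S D*(Dψ) = D R_S(Δ^ηψ) = D(Δ^ηψ)` (`R_S` fixes `Δ^η N_S`). [cite: Balaban1985BackgroundPropagators, (3.26) p.395, (3.115) p.418, (3.23)–(3.25) p.394] -/
theorem laplaceA_DL2_eq_of_mem_NS {ψ : SiteL2K ℂ 3 (periodsT3 F K) c₀ W₂} (hψ : ψ ∈ NS F n K h c₀ cB U₀) :
    laplaceA F n K h c₀ cB a Δx U₀ (DL2 F n K c₀ U₀ ψ) = Δx U₀ (DL2 F n K c₀ U₀ ψ) + DL2 F n K c₀ U₀ (covLapSite F n K c₀ U₀ ψ) := by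
  have hQ : Qk F n K h c₀ cB U₀ (DL2 F n K c₀ U₀ ψ) = 0 := by
    rw [Qk, LinearMap.smul_apply, QL2_DL2_eq_zero_of_mem_NS U₀ hψ, smul_zero]
  rw [laplaceA_apply, hQ, smul_zero, map_zero, add_zero]
  show Δx U₀ (DL2 F n K c₀ U₀ ψ) + DL2 F n K c₀ U₀ (RS F n K h c₀ cB U₀ (covLapSite F n K c₀ U₀ ψ)) = _
  rw [RS_apply_covLapSite_of_mem U₀ hψ]

/-- **The `hXY` of (OF-GRAD) for `X := toL2⁻¹(Dψ)`, `Y := toL2⁻¹(Δx(Dψ) + D(Δ^ηψ))`.** [cite: Balaban1985BackgroundPropagators, (3.26) p.395, (3.115) p.418] -/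
theorem laplaceA_toL2_symm_DL2_eq {ψ : SiteL2K ℂ 3 (periodsT3 F K) c₀ W₂} (hψ : ψ ∈ NS F n K h c₀ cB U₀) :
    laplaceA F n K h c₀ cB a Δx U₀ (toL2 F K c₀ ((toL2 F K c₀).symm (DL2 F n K c₀ U₀ ψ))) =
      toL2 F K c₀ ((toL2 F K c₀).symm (Δx U₀ (DL2 F n K c₀ U₀ ψ) + DL2 F n K c₀ U₀ (covLapSite F n K c₀ U₀ ψ))) := by
  rw [LinearEquiv.apply_symm_apply, LinearEquiv.apply_symm_apply]
  exact laplaceA_DL2_eq_of_mem_NS F h c₀ cB a Δx U₀ hψ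

omit [Fact (0 < cB)] in
/-- **(D) VANISHES ON A GAUGE MODE: `D(D*(Dψ) − R_S(D*(Dψ))) = 0` for `ψ ∈ N_S`** (`D*D = Δ^η`, `R_S` fixes `Δ^η N_S`). [cite: Balaban1985BackgroundPropagators, (3.23)–(3.25) p.394] -/
theorem DL2_sub_RS_DstarL2_DL2_eq_zero {ψ : SiteL2K ℂ 3 (periodsT3 F K) c₀ W₂} (hψ : ψ ∈ NS F n K h c₀ cB U₀) :
    DL2 F n K c₀ U₀ (DstarL2 F n K c₀ U₀ (DL2 F n K c₀ U₀ ψ) - RS F n K h c₀ cB U₀ (DstarL2 F n K c₀ U₀ (DL2 F n K c₀ U₀ ψ))) = 0 := by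
  show DL2 F n K c₀ U₀ (covLapSite F n K c₀ U₀ ψ - RS F n K h c₀ cB U₀ (covLapSite F n K c₀ U₀ ψ)) = 0
  rw [RS_apply_covLapSite_of_mem U₀ hψ, sub_self, map_zero]

/-- **(Q) VANISHES ON A GAUGE MODE: `Q_k†(a•Q_k(Dψ)) = 0` for `ψ ∈ N_S`** ((3.115)). [cite: Balaban1985BackgroundPropagators, (3.115) p.418] -/
theorem adjoint_Qk_smul_Qk_DL2_eq_zero {ψ : SiteL2K ℂ 3 (periodsT3 F K) c₀ W₂} (hψ : ψ ∈ NS F n K h c₀ cB U₀) :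
    LinearMap.adjoint (Qk F n K h c₀ cB U₀) (((a : ℝ) : ℂ) • Qk F n K h c₀ cB U₀ (DL2 F n K c₀ U₀ ψ)) = 0 := by
  rw [Qk, LinearMap.smul_apply, QL2_DL2_eq_zero_of_mem_NS U₀ hψ, smul_zero, smul_zero, map_zero]

/-! ## §2 T1-core read on the route's bonds -/

include hε₀ hε1 hreg in
/-- ★★ **T1-core ON THE ROUTE's BONDS**: for ANY site field `ψ` with `‖ψ‖_∞ ≤ M_ψ`, `‖Δ^η_{U₀}ψ‖_∞ ≤ M_φ` (torus currency), under `RegPr`, the room and the margin,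
`‖(toL2⁻¹(D_{U₀}ψ))(b)‖ ≤ 2·(C_g·(M_ψ·c(ε₀) + M_φ) + 2√2·48ε₀·M_ψ)` at EVERY route bond `b` (✓`norm_equiv_DL2_le_of_sup` at `u := ψ`, `q := −Δ^ηψ`; `‖frobEquiv v‖ ≤ ‖v‖`).
[cite: Balaban1985BackgroundPropagators, Lemma 3.2 (3.45)–(3.48) pp.398–399, Thm 3.1 (3.42) p.397] -/
theorem norm_toL2_symm_DL2_le_of_sup (ψ : SiteL2K ℂ 3 (periodsT3 F K) c₀ W₂) {Mψ Mφ : ℝ} (hMψ0 : 0 ≤ Mψ) (hMφ0 : 0 ≤ Mφ)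
    (hMψ : ∀ x : TSite 3 (periodsT3 F K), ‖WL2.equiv ℂ (fun _ : TSite 3 (periodsT3 F K) => c₀) W₂ ψ x‖ ≤ Mψ)
    (hMφ : ∀ x : TSite 3 (periodsT3 F K), ‖WL2.equiv ℂ (fun _ : TSite 3 (periodsT3 F K) => c₀) W₂ (covLapSite F n K c₀ U₀ ψ) x‖ ≤ Mφ)
    (hroom : 2 * (12 * F.L ^ (K - n) + 5) ≤ (F.P K).sitesPerDir 0)
    (hsmall : exists_curved_localGradient.choose * ((48 * ε₀) * (6 * Real.sqrt 2 * Real.sqrt 10 + 6 * Real.sqrt 2)) ≤ 1 / 2)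
    (b : PBond (F.P K) 0) :
    ‖(toL2 F K c₀).symm (DL2 F n K c₀ U₀ ψ) b‖
      ≤ 2 * (exists_curved_localGradient.choose *
            (Mψ * (2 + 2 * Real.sqrt 2 * (4 * ε₀ * (3 + 2457 * norm_bgOfCfg_axialT_sub_le.choose)) + (24 * Real.sqrt 10 + 48) * (48 * ε₀) ^ 2) + Mφ)
          + 2 * Real.sqrt 2 * (48 * ε₀) * Mψ) := by
  have heq : covLapSite F n K c₀ U₀ ψ + (-covLapSite F n K c₀ U₀ ψ) = DstarL2 F n K c₀ U₀ 0 := by rw [add_neg_cancel, map_zero]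
  have hMq : ∀ x : TSite 3 (periodsT3 F K), ‖WL2.equiv ℂ (fun _ : TSite 3 (periodsT3 F K) => c₀) W₂ (-covLapSite F n K c₀ U₀ ψ) x‖ ≤ Mφ := by
    intro x
    have hx : WL2.equiv ℂ (fun _ : TSite 3 (periodsT3 F K) => c₀) W₂ (-covLapSite F n K c₀ U₀ ψ) x =
        -(WL2.equiv ℂ (fun _ : TSite 3 (periodsT3 F K) => c₀) W₂ (covLapSite F n K c₀ U₀ ψ) x) := rfl
    rw [hx, norm_neg]; exact hMφ x
  rw [toL2_symm_apply]
  exact (norm_frobEquiv_le _).trans (norm_equiv_DL2_le_of_sup F n K hε₀ hε1 U₀ hreg c₀ _ _ heq hMψ0 hMφ0 hMψ hMq hroom hsmall _)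

/-! ## §3 The Hessian row -/

include hε₀ hε1 hreg in
/-- ★★★ **THE HESSIAN ROW OF `(Δ₀|_{N_S})⁻¹` (N6 item 6 «HESS-T1»).**  For `ψ ∈ N_S(U₀)` at a printed-regular background, ANY Hessian slot `Δx`, with the global sup letters
`‖ψ‖_∞ ≤ M_ψ`, `‖Δ^ηψ‖_∞ ≤ M_φ`, the source-gradient letter `‖(toL2⁻¹(D(Δ^ηψ)))(b)‖ ≤ G_φ`, the gauge-mode letters `‖(toL2⁻¹(Δx(Dψ)))(b)‖ ≤ M_C`, `‖(toL2⁻¹(Δ^η(Dψ)))(b)‖ ≤ M_E`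
((C-val) = (3.117) current pairing), the room and the margin: EVERY second covariant derivative of `ψ` is bounded,
`‖covGradT η (bgUnits U₀) (toL2⁻¹(Dψ)) μ ν x‖ ≤ (OF-GRAD)'s bound at `s := T₁(M_ψ, M_φ)`, `M_Y := M_C + G_φ`, `M_X := M_C + M_E`, `M_D := 0`, `M_Q := 0`.
[cite: Balaban1985BackgroundPropagators, Thm 3.1 (3.42)–(3.45) pp.397–398, (3.115)–(3.117) pp.418–419, p.423; Balaban1985Variational, (19) p.281, (134)–(135) p.298] -/
theorem norm_covGradT_DL2_le_of_letters {ψ : SiteL2K ℂ 3 (periodsT3 F K) c₀ W₂} (hψ : ψ ∈ NS F n K h c₀ cB U₀)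
    {Mψ Mφ Gφ MC ME : ℝ} (hMψ0 : 0 ≤ Mψ) (hMφ0 : 0 ≤ Mφ) (hGφ0 : 0 ≤ Gφ) (hMC0 : 0 ≤ MC) (hME0 : 0 ≤ ME)
    (hMψ : ∀ x : TSite 3 (periodsT3 F K), ‖WL2.equiv ℂ (fun _ : TSite 3 (periodsT3 F K) => c₀) W₂ ψ x‖ ≤ Mψ)
    (hMφ : ∀ x : TSite 3 (periodsT3 F K), ‖WL2.equiv ℂ (fun _ : TSite 3 (periodsT3 F K) => c₀) W₂ (covLapSite F n K c₀ U₀ ψ) x‖ ≤ Mφ)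
    (hGφ : ∀ b : PBond (F.P K) 0, ‖(toL2 F K c₀).symm (DL2 F n K c₀ U₀ (covLapSite F n K c₀ U₀ ψ)) b‖ ≤ Gφ)
    (hMC : ∀ b : PBond (F.P K) 0, ‖(toL2 F K c₀).symm (Δx U₀ (DL2 F n K c₀ U₀ ψ)) b‖ ≤ MC)
    (hME : ∀ b : PBond (F.P K) 0, ‖(toL2 F K c₀).symm ((DeltaEta F n K c₀ U₀ : BondL2K ℂ 3 (periodsT3 F K) c₀ W₂ →ₗ[ℂ] BondL2K ℂ 3 (periodsT3 F K) c₀ W₂) (DL2 F n K c₀ U₀ ψ)) b‖ ≤ ME)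
    (hroom : 2 * (12 * F.L ^ (K - n) + 5) ≤ (F.P K).sitesPerDir 0)
    (hsmall : exists_curved_localGradient.choose * ((48 * ε₀) * (6 * Real.sqrt 2 * Real.sqrt 10 + 6 * Real.sqrt 2)) ≤ 1 / 2)
    (μ ν : Fin (F.P K).d) (x : Site (F.P K) 0) :
    ‖covGradT (eta F n K) (bgUnits F K U₀) ((toL2 F K c₀).symm (DL2 F n K c₀ U₀ ψ)) μ ν x‖
      ≤ 2 * (exists_curved_localGradient.choose * ((Real.sqrt 2 * (2 * (exists_curved_localGradient.choose * (Mψ * (2 + 2 * Real.sqrt 2 * (4 * ε₀ * (3 + 2457 * norm_bgOfCfg_axialT_sub_le.choose)) + (24 * Real.sqrt 10 + 48) * (48 * ε₀) ^ 2) + Mφ) + 2 * Real.sqrt 2 * (48 * ε₀) * Mψ))) * (2 + 2 * Real.sqrt 2 * (4 * ε₀ * (3 + 2457 * norm_bgOfCfg_axialT_sub_le.choose)) + (24 * Real.sqrt 10 + 48) * (48 * ε₀) ^ 2) + (Real.sqrt 2 * (32 * ε₀ * (2 * (exists_curved_localGradient.choose * (Mψ * (2 + 2 * Real.sqrt 2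 * (4 * ε₀ * (3 + 2457 * norm_bgOfCfg_axialT_sub_le.choose)) + (24 * Real.sqrt 10 + 48) * (48 * ε₀) ^ 2) + Mφ) + 2 * Real.sqrt 2 * (48 * ε₀) * Mψ)) + (MC + ME) + 0 + 0 + (MC + Gφ)))) + 2 * Real.sqrt 2 * (48 * ε₀) * (Real.sqrt 2 * (2 * (exists_curved_localGradient.choose * (Mψ * (2 + 2 * Real.sqrt 2 * (4 * ε₀ * (3 + 2457 * norm_bgOfCfg_axialT_sub_le.choose)) + (24 * Real.sqrt 10 + 48) * (48 * ε₀) ^ 2) + Mφ) + 2 * Real.sqrt 2 * (48 * ε₀) * Mψ)))) := by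
  -- the one-form and its source
  set X : (PBond (F.P K) 0 → Matrix (Fin 2) (Fin 2) ℂ) := (toL2 F K c₀).symm (DL2 F n K c₀ U₀ ψ) with hXdef
  set Y : (PBond (F.P K) 0 → Matrix (Fin 2) (Fin 2) ℂ) :=
    (toL2 F K c₀).symm (Δx U₀ (DL2 F n K c₀ U₀ ψ) + DL2 F n K c₀ U₀ (covLapSite F n K c₀ U₀ ψ)) with hYdef
  -- the coupling of the auxiliary one-form operator is immaterial on a gauge mode; take `0`
  have hXY : laplaceA F n K h c₀ cB 0 Δx U₀ (toL2 F K c₀ X) = toL2 F K c₀ Y := laplaceA_toL2_symm_DL2_eq F h c₀ cB 0 Δx U₀ hψ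
  have htoX : toL2 F K c₀ X = DL2 F n K c₀ U₀ ψ := LinearEquiv.apply_symm_apply _ _
  -- the component sup from T1-core
  set s : ℝ := 2 * (exists_curved_localGradient.choose *
      (Mψ * (2 + 2 * Real.sqrt 2 * (4 * ε₀ * (3 + 2457 * norm_bgOfCfg_axialT_sub_le.choose)) + (24 * Real.sqrt 10 + 48) * (48 * ε₀) ^ 2) + Mφ)
    + 2 * Real.sqrt 2 * (48 * ε₀) * Mψ) with hsdef
  have hX : ∀ b, ‖X b‖ ≤ s := fun b => norm_toL2_symm_DL2_le_of_sup F c₀ U₀ hε₀ hε1 hreg ψ hMψ0 hMφ0 hMψ hMφ hroom hsmall b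
  have hCg0 : 0 ≤ exists_curved_localGradient.choose := exists_curved_localGradient.choose_spec.1
  obtain ⟨hC0, -⟩ := norm_bgOfCfg_axialT_sub_le.choose_spec
  have hs : 0 ≤ s := by positivity
  -- the source letter
  have hY : ∀ b, ‖Y b‖ ≤ MC + Gφ := by
    intro b
    rw [hYdef, map_add, Pi.add_apply]
    exact (norm_add_le _ _).trans (add_le_add (hMC b) (hGφ b))
  -- the slot letter
  have hXs : ∀ b : PBond (F.P K) 0, ‖(toL2 F K c₀).symm ((Δx U₀ - (DeltaEta F n K c₀ U₀ : BondL2K ℂ 3 (periodsT3 F K) c₀ W₂ →ₗ[ℂ] BondL2K ℂ 3 (periodsT3 F K) c₀ W₂))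
      (toL2 F K c₀ X)) b‖ ≤ MC + ME := by
    intro b
    rw [htoX, LinearMap.sub_apply, map_sub, Pi.sub_apply]
    exact (norm_sub_le _ _).trans (add_le_add (hMC b) (hME b))
  -- (D) and (Q) vanish
  have hD : ∀ b : PBond (F.P K) 0, ‖(toL2 F K c₀).symm (DL2 F n K c₀ U₀ (DstarL2 F n K c₀ U₀ (toL2 F K c₀ X)
      - RS F n K h c₀ cB U₀ (DstarL2 F n K c₀ U₀ (toL2 F K c₀ X)))) b‖ ≤ 0 := by
    intro b
    rw [htoX, DL2_sub_RS_DstarL2_DL2_eq_zero F h c₀ cB U₀ hψ, map_zero, Pi.zero_apply, norm_zero]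
  have hQ : ∀ b : PBond (F.P K) 0, ‖(toL2 F K c₀).symm (LinearMap.adjoint (Qk F n K h c₀ cB U₀)
      ((((0 : ℝ) : ℝ) : ℂ) • Qk F n K h c₀ cB U₀ (toL2 F K c₀ X))) b‖ ≤ 0 := by
    intro b
    rw [htoX, adjoint_Qk_smul_Qk_DL2_eq_zero F h c₀ cB 0 U₀ hψ, map_zero, Pi.zero_apply, norm_zero]
  exact norm_covGradT_le_of_letters F h c₀ cB 0 Δx U₀ hε₀ hε1 hreg X Y hXY hs (add_nonneg hMC0 hGφ0) (add_nonneg hMC0 hME0) le_rfl le_rfl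
    hX hY hXs hD hQ hroom hsmall μ ν x

/-! ## §4 The slots of record -/

include hε₀ hε1 hreg in
/-- ★★★ **THE HESSIAN ROW AT THE SLOT OF RECORD `G₀` (`Δx := DeltaEtaSlot`): ONE gauge-mode letter `M_E`** (`M_C := M_E`, since `DeltaEtaSlot U₀ = Δ^η(U₀)` by `rfl`).
[cite: Balaban1985BackgroundPropagators, (3.26)–(3.27) p.395, (3.117) p.419, Thm 3.1 (3.42)–(3.45) pp.397–398] -/
theorem norm_covGradT_DL2_le_DeltaEtaSlot {ψ : SiteL2K ℂ 3 (periodsT3 F K) c₀ W₂} (hψ : ψ ∈ NS F n K h c₀ cB U₀)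
    {Mψ Mφ Gφ ME : ℝ} (hMψ0 : 0 ≤ Mψ) (hMφ0 : 0 ≤ Mφ) (hGφ0 : 0 ≤ Gφ) (hME0 : 0 ≤ ME)
    (hMψ : ∀ x : TSite 3 (periodsT3 F K), ‖WL2.equiv ℂ (fun _ : TSite 3 (periodsT3 F K) => c₀) W₂ ψ x‖ ≤ Mψ)
    (hMφ : ∀ x : TSite 3 (periodsT3 F K), ‖WL2.equiv ℂ (fun _ : TSite 3 (periodsT3 F K) => c₀) W₂ (covLapSite F n K c₀ U₀ ψ) x‖ ≤ Mφ)
    (hGφ : ∀ b : PBond (F.P K) 0, ‖(toL2 F K c₀).symm (DL2 F n K c₀ U₀ (covLapSite F n K c₀ U₀ ψ)) b‖ ≤ Gφ)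
    (hME : ∀ b : PBond (F.P K) 0, ‖(toL2 F K c₀).symm ((DeltaEta F n K c₀ U₀ : BondL2K ℂ 3 (periodsT3 F K) c₀ W₂ →ₗ[ℂ] BondL2K ℂ 3 (periodsT3 F K) c₀ W₂) (DL2 F n K c₀ U₀ ψ)) b‖ ≤ ME)
    (hroom : 2 * (12 * F.L ^ (K - n) + 5) ≤ (F.P K).sitesPerDir 0)
    (hsmall : exists_curved_localGradient.choose * ((48 * ε₀) * (6 * Real.sqrt 2 * Real.sqrt 10 + 6 * Real.sqrt 2)) ≤ 1 / 2)
    (μ ν : Fin (F.P K).d) (x : Site (F.P K) 0) :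
    ‖covGradT (eta F n K) (bgUnits F K U₀) ((toL2 F K c₀).symm (DL2 F n K c₀ U₀ ψ)) μ ν x‖
      ≤ 2 * (exists_curved_localGradient.choose * ((Real.sqrt 2 * (2 * (exists_curved_localGradient.choose * (Mψ * (2 + 2 * Real.sqrt 2 * (4 * ε₀ * (3 + 2457 * norm_bgOfCfg_axialT_sub_le.choose)) + (24 * Real.sqrt 10 + 48) * (48 * ε₀) ^ 2) + Mφ) + 2 * Real.sqrt 2 * (48 * ε₀) * Mψ))) * (2 + 2 * Real.sqrt 2 * (4 * ε₀ * (3 + 2457 * norm_bgOfCfg_axialT_sub_le.choose)) + (24 * Real.sqrt 10 + 48) * (48 * ε₀) ^ 2) + (Real.sqrt 2 * (32 * ε₀ * (2 * (exists_curved_localGradient.choose * (Mψ * (2 + 2 * Real.sqrt 2 * (4 * ε₀ * (3 + 2457 * norm_bgOfCfg_axialT_sub_le.choose)) + (24 * Real.sqrt 10 + 48) * (48 * ε₀) ^ 2) + Mφ) + 2 * Real.sqrt 2 * (48 * ε₀) * Mψ)) + (ME + ME) + 0 + 0 + (ME + Gφ)))) + 2 * Real.sqrt 2 * (48 * ε₀)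 * (Real.sqrt 2 * (2 * (exists_curved_localGradient.choose * (Mψ * (2 + 2 * Real.sqrt 2 * (4 * ε₀ * (3 + 2457 * norm_bgOfCfg_axialT_sub_le.choose)) + (24 * Real.sqrt 10 + 48) * (48 * ε₀) ^ 2) + Mφ) + 2 * Real.sqrt 2 * (48 * ε₀) * Mψ)))) := by
  have hMC : ∀ b : PBond (F.P K) 0, ‖(toL2 F K c₀).symm (DeltaEtaSlot F n K c₀ U₀ (DL2 F n K c₀ U₀ ψ)) b‖ ≤ ME := fun b => hME b
  exact norm_covGradT_DL2_le_of_letters F h c₀ cB (DeltaEtaSlot F n K c₀) U₀ hε₀ hε1 hreg hψ hMψ0 hMφ0 hGφ0 hME0 hME0 hMψ hMφ hGφ hMC hME hroom hsmall μ ν x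

include hε₀ hε1 hreg in
/-- ★★★ **THE HESSIAN ROW AT THE Π-SLOT (`Δx := DeltaPiSlotP`, `0 ≤ a`): `M_C := 0`** — `Δ_πᴾ(U₀)` KILLS `D_{U₀}N_S` (✓`DeltaPiSlotP_kills_NS`), so only the (3.117) letter `M_E` is displayed.
[cite: Balaban1985BackgroundPropagators, (3.119) p.419, (3.122) p.420, (3.117) p.419, Thm 3.1 (3.42)–(3.45) pp.397–398] -/
theorem norm_covGradT_DL2_le_DeltaPiSlotP (ha : 0 ≤ a) {ψ : SiteL2K ℂ 3 (periodsT3 F K) c₀ W₂} (hψ : ψ ∈ NS F n K h c₀ cB U₀)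
    {Mψ Mφ Gφ ME : ℝ} (hMψ0 : 0 ≤ Mψ) (hMφ0 : 0 ≤ Mφ) (hGφ0 : 0 ≤ Gφ) (hME0 : 0 ≤ ME)
    (hMψ : ∀ x : TSite 3 (periodsT3 F K), ‖WL2.equiv ℂ (fun _ : TSite 3 (periodsT3 F K) => c₀) W₂ ψ x‖ ≤ Mψ)
    (hMφ : ∀ x : TSite 3 (periodsT3 F K), ‖WL2.equiv ℂ (fun _ : TSite 3 (periodsT3 F K) => c₀) W₂ (covLapSite F n K c₀ U₀ ψ) x‖ ≤ Mφ)
    (hGφ : ∀ b : PBond (F.P K) 0, ‖(toL2 F K c₀).symm (DL2 F n K c₀ U₀ (covLapSite F n K c₀ U₀ ψ)) b‖ ≤ Gφ)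
    (hME : ∀ b : PBond (F.P K) 0, ‖(toL2 F K c₀).symm ((DeltaEta F n K c₀ U₀ : BondL2K ℂ 3 (periodsT3 F K) c₀ W₂ →ₗ[ℂ] BondL2K ℂ 3 (periodsT3 F K) c₀ W₂) (DL2 F n K c₀ U₀ ψ)) b‖ ≤ ME)
    (hroom : 2 * (12 * F.L ^ (K - n) + 5) ≤ (F.P K).sitesPerDir 0)
    (hsmall : exists_curved_localGradient.choose * ((48 * ε₀) * (6 * Real.sqrt 2 * Real.sqrt 10 + 6 * Real.sqrt 2)) ≤ 1 / 2)
    (μ ν : Fin (F.P K).d) (x : Site (F.P K) 0) :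
    ‖covGradT (eta F n K) (bgUnits F K U₀) ((toL2 F K c₀).symm (DL2 F n K c₀ U₀ ψ)) μ ν x‖
      ≤ 2 * (exists_curved_localGradient.choose * ((Real.sqrt 2 * (2 * (exists_curved_localGradient.choose * (Mψ * (2 + 2 * Real.sqrt 2 * (4 * ε₀ * (3 + 2457 * norm_bgOfCfg_axialT_sub_le.choose)) + (24 * Real.sqrt 10 + 48) * (48 * ε₀) ^ 2) + Mφ) + 2 * Real.sqrt 2 * (48 * ε₀) * Mψ))) * (2 + 2 * Real.sqrt 2 * (4 * ε₀ * (3 + 2457 * norm_bgOfCfg_axialT_sub_le.choose)) + (24 * Real.sqrt 10 + 48) * (48 * ε₀) ^ 2) + (Real.sqrt 2 * (32 * ε₀ * (2 * (exists_curved_localGradient.choose * (Mψ * (2 + 2 * Real.sqrt 2 * (4 * ε₀ * (3 + 2457 * norm_bgOfCfg_axialT_sub_le.choose)) + (24 * Real.sqrt 10 + 48) * (48 * ε₀) ^ 2) + Mφ) + 2 * Real.sqrt 2 * (48 * ε₀) * Mψ)) + (0 + ME) + 0 + 0 + (0 + Gφ)))) + 2 * Real.sqrt 2 * (48 * ε₀)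 * (Real.sqrt 2 * (2 * (exists_curved_localGradient.choose * (Mψ * (2 + 2 * Real.sqrt 2 * (4 * ε₀ * (3 + 2457 * norm_bgOfCfg_axialT_sub_le.choose)) + (24 * Real.sqrt 10 + 48) * (48 * ε₀) ^ 2) + Mφ) + 2 * Real.sqrt 2 * (48 * ε₀) * Mψ)))) := by
  have hMC : ∀ b : PBond (F.P K) 0, ‖(toL2 F K c₀).symm (DeltaPiSlotP F n K h c₀ cB a U₀ (DL2 F n K c₀ U₀ ψ)) b‖ ≤ 0 := fun b => by
    rw [DeltaPiSlotP_kills_NS ha ψ hψ, map_zero, Pi.zero_apply, norm_zero]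
  exact norm_covGradT_DL2_le_of_letters F h c₀ cB (DeltaPiSlotP F n K h c₀ cB a) U₀ hε₀ hε1 hreg hψ hMψ0 hMφ0 hGφ0 le_rfl hME0 hMψ hMφ hGφ hMC hME hroom hsmall μ ν x

end Summit.QuantumFields.YangMills.Theorems.Prop7GaugeModeHessianRow

end
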